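import Mathlib
import Literature.NumberTheory.Automorphic.UnboundedDenominatorsReductions
import Summits.Langlands.Langlands.Theorems.CapacityClassicalityHilbertIntegralOverconvergentIsCongruenceStubCoeffInvBound
import Summits.Langlands.Langlands.Theorems.CapacityClassicalityHilbertIntegralOverconvergentIsCongruenceStubCoeffMulBound

/-!
# Stub `stub_modularSupNormOfCusp` for line `Sketch-ideate-r1-k1` (crux stmt-Langlands-8485)

**From cusp forms to modular forms by the `Δ`-twist.**  Fix a prime `p`, a level `N ≥ 1` and a
ring isomorphism `ι : ℚ̄_p ≃ ℂ`, and write `μ = [SL₂(ℤ) : Γ₁(N)]`.  Suppose the sup-norm Sturm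
principle along `ι` holds for CUSP forms on `Γ₁(N)`: for every weight `W`, every
`G ∈ S_W(Γ₁(N))` and every `ε ≥ 0`, if `‖ι⁻¹ a_m(G)‖ ≤ ε` for all `m ≤ ⌊(W μ)⁺ / 12⌋` then
`‖ι⁻¹ a_m(G)‖ ≤ ε` for all `m`.  Then the same principle holds for MODULAR forms
`F ∈ M_{k'}(Γ₁(N))` with the bound `⌊((12 + k') μ)⁺ / 12⌋` (strict inequality): if
`‖ι⁻¹ a_n(F)‖ ≤ B` for all `n < ⌊((12 + k') μ)⁺ / 12⌋` then `‖ι⁻¹ a_n(F)‖ ≤ B` for all `n`.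

Proof.  `G := Δ · F` is a cusp form of weight `12 + k'` on `Γ₁(N)` with
`qExpansion 1 G = qExpansion 1 Δ · qExpansion 1 F` (`Δ` restricted from level one,
`CuspForm.mulModularForm`, `ModularForm.qExpansion_mul_coe`), and `qExpansion 1 Δ = X · U` with
`U ∈ ℤ⟦X⟧` of constant term `1` (the tree's
`Literature.NumberTheory.Automorphic.exists_discriminant_qExpansion_natCast_eq_X_pow_mul`).
Reading everything in `ℚ̄_p⟦X⟧` through `PowerSeries.map ι⁻¹` (which fixes `ℤ`, whose elements
have norm `≤ 1`), `a_m(G) = ∑_{i + j = m - 1} u_i a_j(F)` involves only `a_j(F)` with `j < m`, so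
the ultrametric inequality gives `‖ι⁻¹ a_m(G)‖ ≤ B` for `m ≤ ⌊((12 + k') μ)⁺ / 12⌋`; the cusp
principle then bounds all `a_m(G)`; and finally `X · F = G · U⁻¹` with `U⁻¹` integral
(`norm_coeff_inv_le_one`) and the ultrametric product rule (`norm_coeff_mul_le_of_forall_le`)
bound all `a_n(F)`.  No new definitions, no named facts.
-/

set_option linter.dupNamespace false -- `Summit.Langlands.Langlands` is the mandated namespace

open scoped MatrixGroups
open UpperHalfPlane CongruenceSubgroup PowerSeries

noncomputable section

namespace Summit.Langlands.Langlands.Theorems.HilbertIntegralOverconvergentIsCongruence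

/-- **The `Δ`-twist.**  For a modular form `F` of weight `k` on `Γ₁(N)`, `Δ · F` is a cusp form
of weight `12 + k` on `Γ₁(N)` whose `q`-expansion (at the strict period `1`) is the product of
the `q`-expansions (`Δ = CuspForm.discriminant` restricted from level one to `Γ₁(N)`;
Mathlib's `CuspForm.mulModularForm` and `ModularForm.qExpansion_mul_coe`). [folklore] -/
theorem exists_cuspForm_qExpansion_eq_discriminant_mul {N : ℕ} {k : ℤ}
    (F : ModularForm (Gamma1 N) k) :
    ∃ G : CuspForm (Gamma1 N) (12 + k),
      qExpansion 1 ⇑G = qExpansion 1 ModularForm.discriminant * qExpansion 1 ⇑F := by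
  have hle : (Gamma1 N : Subgroup (GL (Fin 2) ℝ)) ≤ 𝒮ℒ := by rintro _ ⟨g, -, rfl⟩; exact ⟨g, rfl⟩
  have hΓ : (1 : ℝ) ∈ (Gamma1 N : Subgroup (GL (Fin 2) ℝ)).strictPeriods := by simp
  let Δ' : CuspForm (Gamma1 N) 12 :=
    { toFun := ⇑CuspForm.discriminant
      slash_action_eq' := fun γ hγ ↦
        SlashInvariantFormClass.slash_action_eq CuspForm.discriminant γ (hle hγ)
      holo' := CuspForm.discriminant.holo'
      zero_at_cusps' := fun hc ↦ CuspForm.discriminant.zero_at_cusps' (hc.mono hle) }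
  refine ⟨Δ'.mulModularForm F, ?_⟩
  rw [CuspForm.coe_mulModularForm, ModularForm.qExpansion_mul_coe one_pos hΓ Δ' F]
  rfl

/-- **Registered stub `stub_modularSupNormOfCusp`** (line `Sketch-ideate-r1-k1`, crux
stmt-Langlands-8485).  The sup-norm Sturm principle along `ι : ℚ̄_p ≃ ℂ` for cusp forms on
`Γ₁(N)` (hypothesis, indexed by the weight `W` with bound `⌊(W μ)⁺ / 12⌋`,
`μ = [SL₂(ℤ) : Γ₁(N)]`) implies the principle for modular forms `F ∈ M_{k'}(Γ₁(N))` with the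
bound `n < ⌊((12 + k') μ)⁺ / 12⌋`: twist by `Δ = X · U` (`U ∈ ℤ⟦X⟧ˣ`), apply the cusp principle
in weight `12 + k'`, and untwist by the integral series `U⁻¹`, all norms being ultrametric.
[folklore] -/
theorem stub_modularSupNormOfCusp :
    ∀ (p : ℕ) [Fact p.Prime] (N : ℕ) [NeZero N] (ι : PadicAlgCl p ≃+* ℂ),
      (∀ (W : ℤ) (G : CuspForm (CongruenceSubgroup.Gamma1 N) W) (ε : ℝ), 0 ≤ ε →
        (∀ m : ℕ, m ≤ (W * ((CongruenceSubgroup.Gamma1 N).index : ℤ)).toNat / 12 →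
          ‖ι.symm (PowerSeries.coeff m (UpperHalfPlane.qExpansion 1 ⇑G))‖ ≤ ε) →
        ∀ m : ℕ, ‖ι.symm (PowerSeries.coeff m (UpperHalfPlane.qExpansion 1 ⇑G))‖ ≤ ε) →
      ∀ (k' : ℤ) (F : ModularForm (CongruenceSubgroup.Gamma1 N) k') (B : ℝ), 0 ≤ B →
        (∀ n : ℕ, n < ((12 + k') * ((CongruenceSubgroup.Gamma1 N).index : ℤ)).toNat / 12 →
          ‖ι.symm (PowerSeries.coeff n (UpperHalfPlane.qExpansion 1 ⇑F))‖ ≤ B) →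
        ∀ n : ℕ, ‖ι.symm (PowerSeries.coeff n (UpperHalfPlane.qExpansion 1 ⇑F))‖ ≤ B := by
  intro p _ N _ ι hSup k' F B hB hF
  -- transport along `ι⁻¹ : ℂ → ℚ̄_p`
  obtain ⟨f, hf_def⟩ : ∃ f : ℂ →+* PadicAlgCl p, f = ι.symm.toRingHom := ⟨_, rfl⟩
  have hf : ∀ (Q : PowerSeries ℂ) (n : ℕ), ι.symm (coeff n Q) = coeff n (Q.map f) := fun Q n ↦ by
    rw [coeff_map, hf_def]
    rfl
  -- the twist `G = Δ · F`, a cusp form of weight `12 + k'`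
  obtain ⟨G, hG⟩ := exists_cuspForm_qExpansion_eq_discriminant_mul F
  -- `Δ = X · U` with `U ∈ ℤ⟦X⟧`, `U(0) = 1`
  obtain ⟨U, hU1, hU⟩ :=
    Literature.NumberTheory.Automorphic.exists_discriminant_qExpansion_natCast_eq_X_pow_mul
      (h := 1) one_pos
  rw [Nat.cast_one, pow_one] at hU
  -- `u`: the image of `U` in `ℚ̄_p⟦X⟧` — integral, constant term `1`
  obtain ⟨u, hu_def⟩ : ∃ u : PowerSeries (PadicAlgCl p),
      u = (U.map (Int.castRingHom ℂ)).map f := ⟨_, rfl⟩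
  have huZ : ∀ n, coeff n u = ((coeff n U : ℤ) : PadicAlgCl p) := fun n ↦ by
    rw [hu_def, coeff_map, coeff_map, eq_intCast, map_intCast]
  have hu : ∀ n, ‖coeff n u‖ ≤ 1 := fun n ↦ by
    rw [huZ]
    exact IsUltrametricDist.norm_intCast_le_one _ _
  have hu0 : constantCoeff u = 1 := by
    rw [← coeff_zero_eq_constantCoeff_apply, huZ, coeff_zero_eq_constantCoeff_apply, hU1,
      Int.cast_one]
  -- `φ`: the image of `qExpansion 1 F`; the image of `qExpansion 1 G` is `X · (u · φ)`
  obtain ⟨φ, hφ_def⟩ : ∃ φ : PowerSeries (PadicAlgCl p), φ = (qExpansion 1 ⇑F).map f :=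
    ⟨_, rfl⟩
  have hγ : (qExpansion 1 ⇑G).map f = X * (u * φ) := by
    rw [hG, hU, map_mul, map_mul, map_X, mul_assoc, hu_def, hφ_def]
  -- Step 1: the bound for `G` up to the Sturm line of weight `12 + k'`
  have hF' : ∀ n, n < ((12 + k') * ((Gamma1 N).index : ℤ)).toNat / 12 → ‖coeff n φ‖ ≤ B :=
    fun n hn ↦ by
    rw [hφ_def, ← hf]
    exact hF n hn
  have hGtrunc : ∀ m : ℕ, m ≤ ((12 + k') * ((Gamma1 N).index : ℤ)).toNat / 12 →
      ‖ι.symm (coeff m (qExpansion 1 ⇑G))‖ ≤ B := by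
    intro m hm
    rw [hf, hγ]
    rcases m with _ | m
    · rw [coeff_zero_X_mul, norm_zero]
      exact hB
    · rw [coeff_succ_X_mul, coeff_mul]
      refine IsUltrametricDist.norm_sum_le_of_forall_le_of_nonneg hB fun x hx ↦ ?_
      rw [Finset.HasAntidiagonal.mem_antidiagonal] at hx
      rw [norm_mul]
      calc ‖coeff x.1 u‖ * ‖coeff x.2 φ‖ ≤ 1 * B :=
            mul_le_mul (hu _) (hF' _ (by omega)) (norm_nonneg _) zero_le_one
        _ = B := one_mul B
  -- Step 2: the cusp principle in weight `12 + k'` bounds every coefficient of `G`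
  have hGall : ∀ m, ‖coeff m (X * (u * φ))‖ ≤ B := fun m ↦ by
    rw [← hγ, ← hf]
    exact hSup (12 + k') G B hB hGtrunc m
  -- Step 3: untwist, `X · φ = (X · u · φ) · u⁻¹` with `u⁻¹` integral
  intro n
  have hu0' : constantCoeff u ≠ 0 := by
    rw [hu0]
    exact one_ne_zero
  have hkey : X * φ = X * (u * φ) * u⁻¹ := by
    rw [mul_assoc, mul_comm u φ, mul_assoc, PowerSeries.mul_inv_cancel u hu0', mul_one]
  rw [hf, ← hφ_def, ← coeff_succ_X_mul n φ, hkey]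
  simpa only [mul_one] using norm_coeff_mul_le_of_forall_le _ _ hB zero_le_one hGall
    (norm_coeff_inv_le_one u hu0 hu) (n + 1)

end Summit.Langlands.Langlands.Theorems.HilbertIntegralOverconvergentIsCongruence

end
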